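import Summits.CriticalPhenomena.PercolationContinuityZ3.Theorems.PercNearOneGluingNoHeavyLowerTailSunflowerUpReader
import HarnessLib
import HarnessLib.Audit

/-!
# `NoHeavyLowerTail` (crux stmt-CriticalPhenomena-4575), abstract sunflower cubic: ★ FOR EVERY SUNFLOWER WITHOUT TWO DISJOINT PETAL-1 SETS
# HAVING KERNEL COMPLEMENTS (a new unconditional class, strictly containing "petal 1 intersecting")

Support file (seat `prim-l12-p2` gen 23; `--supports stmt-CriticalPhenomena-4575`).  No `sorry`, no new definitions.
Memo: run/shared/lean/prim/prim-l12/prim-l12-p2/FINDING-g23-BILINEAR-CERTIFICATE.md (§8).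

THEOREM (`Sunflower.rbVec_linearIndependent_of_noDisjointKernelPair`, `Sunflower.ZH_nonneg_of_noDisjointKernelPair`).  If a sunflower has
NO two disjoint petal-1 sets `P, P'` (`lab P = lab P' = 1`) whose complements are both kernel sets, then its two-stage rainbow vectors
`rbVec ρ` are linearly independent over `GF(2)` (`RainbowKernelIndependence` for this sunflower), hence `0 ≤ ZH` (★).
Gen 20's theorem assumed the whole petal `C₁` intersecting; here only the petal-1 sets with kernel complement matter (by petal symmetry any
petal may play the role of `C₁`).  CENSUS (gen 23, `code/globsl.c`): n ≤ 5 exhaustive — the hypothesis holds for some petal in 275 315 892 of the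
275 665 902 monotone maps `2^5 → M₃`, against 275 140 062 having an intersecting petal.
PROOF.  Let `Σ g_ρ rbVec ρ = 0`, `g ≠ 0`; choose `ρ*` in the support with `|Q1|` maximal, `P = Q1(ρ*)`.  For every kernel–bottom pair `O` of the
cube `Pᶜ` apply the UP-READER `Λ_P` of the bottom cube `Oᶜ` (`…SunflowerUpReader`: the sum of the `M`-rows `Y ⊆ Oᶜ∖P` with kernel complement) at
the slice `O`: it reads `rbVec ρ` as `[slice condition]·M^{Pᶜ}(Q3ρ, O)·[P ⊆ Q1ρ]` (`rbVec_pair_bottom_raw` + `nu_read_up`; the hypothesis of the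
up-reader is exactly the global hypothesis), and maximality of `|Q1|` forces `Q1ρ = P` on the support.  So the `(2|3)`-rows `M^{Pᶜ}(Q3ρ,·)`,
`Q1ρ = P`, carry the dependency `Σ g_ρ M(Q3ρ,·) = 0` — contradicting the cube theorem `cross_kernel_trivial` (cross rows are independent).
-/

namespace Summit.CriticalPhenomena.PercolationContinuityZ3.Theorems.SunflowerPartition

open Finset

variable {α : Type*} [Fintype α] [DecidableEq α]

namespace Sunflower

variable (F : Sunflower α)

/-- **Raw pairing of an arbitrary `M`-row with `rbVec` at a bottom slice** (this work): for a rainbow `ρ`, a bottom set `S` and ANY `Z ⊆ Sᶜ`,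
`Σ_σ [σ.2 = S]·#{R' ∈ B : (σ.1∪σ.2)ᶜ ⊆ R' ⊆ Z}·rbVec ρ σ = [TS-B condition of ρ at S]·m_ρ(S)·Σ_{O ⊆ Sᶜ} M(Z,O)·ν_{Q1}(O)`
(the version of `rbVec_read_bottom` before the reading step; no label hypothesis on `Z`). [this work] -/
theorem rbVec_pair_bottom_raw {ρ : Finset α × Finset α} (hρ : ρ ∈ F.dem) (hr : F.IsRainbow ρ) {S Z : Finset α}
    (hS0 : F.lab S = 0) (hZ : Z ⊆ Sᶜ) :
    (∑ σ ∈ F.sup, (if σ.2 = S then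
        (∑ R' ∈ (Sᶜ).powerset, (if F.lab R' = 0 ∧ (σ.1 ∪ σ.2)ᶜ ⊆ R' ∧ R' ⊆ Z then (1 : ZMod 2) else 0)) * F.rbVec ρ σ else 0))
      = if F.lab S = 0 ∧ S ⊆ (ρ.1 ∪ ρ.2)ᶜ ∧ F.lab (Sᶜ \ ρ.1) = 4 then
          (∑ R' ∈ (Finset.univ : Finset α).powerset, (if F.lab R' = 0 ∧ S ⊆ R' ∧ R' ⊆ (ρ.1 ∪ ρ.2)ᶜ then (1 : ZMod 2) else 0)) *
          (∑ O ∈ (Sᶜ).powerset,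
            (∑ R' ∈ (Sᶜ).powerset, (if F.lab R' = 0 ∧ O ⊆ R' ∧ R' ⊆ Z then (1 : ZMod 2) else 0)) *
            (∑ R ∈ (Sᶜ).powerset, (if F.lab R = 4 ∧ ρ.1 ⊆ R ∧ R ⊆ Sᶜ \ O then (1 : ZMod 2) else 0)))
        else 0 := by
  have _hZ := hZ
  obtain ⟨-, hQ1, -, -⟩ := F.dem_rainbow_facts hρ hr
  rw [F.sum_sup_spectator S (Or.inr hS0)]
  by_cases hcond : F.lab S = 0 ∧ S ⊆ (ρ.1 ∪ ρ.2)ᶜ ∧ F.lab (Sᶜ \ ρ.1) = 4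
  · rw [if_pos hcond]
    -- the full `O`-sum equals the sum over kernel–bottom pairs (other terms vanish)
    have hsplit : (∑ O ∈ (Sᶜ).powerset,
            (∑ R' ∈ (Sᶜ).powerset, (if F.lab R' = 0 ∧ O ⊆ R' ∧ R' ⊆ Z then (1 : ZMod 2) else 0)) *
            (∑ R ∈ (Sᶜ).powerset, (if F.lab R = 4 ∧ ρ.1 ⊆ R ∧ R ⊆ Sᶜ \ O then (1 : ZMod 2) else 0)))
        = ∑ O ∈ (Sᶜ).powerset.filter (fun O => F.lab O = 0 ∧ F.lab (Sᶜ \ O) = 4),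
            (∑ R' ∈ (Sᶜ).powerset, (if F.lab R' = 0 ∧ O ⊆ R' ∧ R' ⊆ Z then (1 : ZMod 2) else 0)) *
            (∑ R ∈ (Sᶜ).powerset, (if F.lab R = 4 ∧ ρ.1 ⊆ R ∧ R ⊆ Sᶜ \ O then (1 : ZMod 2) else 0)) := by
      rw [← Finset.sum_filter_add_sum_filter_not (Sᶜ).powerset (fun O => F.lab O = 0 ∧ F.lab (Sᶜ \ O) = 4)]
      rw [show (∑ O ∈ (Sᶜ).powerset.filter (fun O => ¬ (F.lab O = 0 ∧ F.lab (Sᶜ \ O) = 4)),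
            (∑ R' ∈ (Sᶜ).powerset, (if F.lab R' = 0 ∧ O ⊆ R' ∧ R' ⊆ Z then (1 : ZMod 2) else 0)) *
            (∑ R ∈ (Sᶜ).powerset, (if F.lab R = 4 ∧ ρ.1 ⊆ R ∧ R ⊆ Sᶜ \ O then (1 : ZMod 2) else 0))) = 0 from
          sum_eq_zero fun O hO => by
            have hO' := (mem_filter.1 hO).2
            by_cases h0 : F.lab O = 0
            · have h4 : F.lab (Sᶜ \ O) ≠ 4 := fun h => hO' ⟨h0, h⟩
              rw [show (∑ R ∈ (Sᶜ).powerset, (if F.lab R = 4 ∧ ρ.1 ⊆ R ∧ R ⊆ Sᶜ \ O then (1 : ZMod 2) else 0)) = 0 from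
                sum_eq_zero fun R _ => if_neg fun h' => h4 (F.lab_eq_four_of_subset h'.2.2 h'.1), mul_zero]
            · rw [F.crossM_eq_zero_of_lab_ne Sᶜ h0, zero_mul], add_zero]
    rw [hsplit, Finset.mul_sum]
    refine sum_congr rfl fun O hO => ?_
    have hOW : O ⊆ Sᶜ := mem_powerset.1 (mem_filter.1 hO).1
    have h3 : ((Sᶜ \ O) ∪ S)ᶜ = O := third_of_mk hOW
    unfold rbVec
    simp only
    rw [h3, if_pos hcond, if_neg (fun h => by rw [hS0] at h; exact absurd h.1 (by decide)), add_zero]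
    ring
  · rw [if_neg hcond]
    refine sum_eq_zero fun O _ => ?_
    unfold rbVec
    simp only
    rw [if_neg hcond, if_neg (fun h => by rw [hS0] at h; exact absurd h.1 (by decide)), add_zero, mul_zero]

omit [Fintype α] in
/-- `lab (S ∪ T) = 4` for a label-`2` set `S` and a label-`3` set `T`. [this work] -/
theorem lab_union_two_three {S T : Finset α} (hS : F.lab S = 2) (hT : F.lab T = 3) : F.lab (S ∪ T) = 4 := by
  rcases F.lab_superset (subset_union_left (s₁ := S) (s₂ := T)) (by rw [hS]; decide) with h1 | h1
  · rcases F.lab_superset (subset_union_right (s₁ := S) (s₂ := T)) (by rw [hT]; decide) with h2 | h2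
    · rw [h1, hS] at h2; rw [hT] at h2; exact absurd h2 (by decide)
    · exact h2
  · exact h1

/-- **`RainbowKernelIndependence` FOR SUNFLOWERS WITHOUT A DISJOINT KERNEL-COMPLEMENT PAIR IN PETAL 1** (this work).  If no two disjoint
label-`1` sets both have kernel complements, the two-stage rainbow vectors `rbVec ρ` are linearly independent over `GF(2)`. [this work] -/
theorem rbVec_linearIndependent_of_noDisjointKernelPair
    (hpw : ∀ P P' : Finset α, F.lab P = 1 → F.lab P' = 1 → F.lab Pᶜ = 4 → F.lab P'ᶜ = 4 → (P ∩ P').Nonempty) :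
    LinearIndependent (ZMod 2)
      (fun ρ : ↥(F.dem.filter (fun d => F.IsRainbow d)) => fun σ : ↥F.sup => F.rbVec ρ.1 σ.1) := by
  classical
  rw [Fintype.linearIndependent_iff]
  intro g hg
  by_contra hne
  push Not at hne
  obtain ⟨i₀, hi₀⟩ := hne
  have rfacts : ∀ i : ↥(F.dem.filter (fun d => F.IsRainbow d)), i.1 ∈ F.dem ∧ F.IsRainbow i.1 := fun i => ⟨(mem_filter.1 i.2).1, (mem_filter.1 i.2).2⟩
  -- evaluation of the dependency at a supply
  have hsum : ∀ σ ∈ F.sup, (∑ i : ↥(F.dem.filter (fun d => F.IsRainbow d)), g i * F.rbVec i.1 σ) = 0 := by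
    intro σ hσ
    have h := congrFun hg ⟨σ, hσ⟩
    simp only [Finset.sum_apply, Pi.smul_apply, smul_eq_mul, Pi.zero_apply] at h
    exact h
  -- the maximal `Q1` in the support
  obtain ⟨s, hsT, hmax⟩ := Finset.exists_max_image ((Finset.univ : Finset ↥(F.dem.filter (fun d => F.IsRainbow d))).filter (fun i => g i ≠ 0))
    (fun i : ↥(F.dem.filter (fun d => F.IsRainbow d)) => i.1.1.card) ⟨i₀, mem_filter.2 ⟨mem_univ _, hi₀⟩⟩
  have hgs : g s ≠ 0 := (mem_filter.1 hsT).2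
  obtain ⟨hdisj, hQ1, hQ2, hQ3⟩ := F.dem_rainbow_facts (rfacts s).1 (rfacts s).2
  have hPc : F.lab (s.1.1)ᶜ = 4 := by
    have : (s.1.1)ᶜ = s.1.2 ∪ (s.1.1 ∪ s.1.2)ᶜ := by
      ext x; simp only [mem_compl, mem_union, not_or]; constructor
      · intro hx; by_cases h2 : x ∈ s.1.2
        · exact Or.inl h2
        · exact Or.inr ⟨hx, h2⟩
      · rintro (h | ⟨h, -⟩)
        · exact fun h1 => (Finset.disjoint_left.1 hdisj) h1 h
        · exact h
    rw [this]; exact F.lab_union_two_three hQ2 hQ3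
  -- STEP A: for every kernel–bottom pair `S` of the cube `(Q1 s)ᶜ`, the rows with `Q1 = Q1 s` carry the dependency
  have key : ∀ S, S ⊆ (s.1.1)ᶜ → F.lab S = 0 → F.lab (Sᶜ \ s.1.1) = 4 →
      (∑ i : ↥(F.dem.filter (fun d => F.IsRainbow d)), g i * (if i.1.1 = s.1.1 then
        (∑ R' ∈ (Finset.univ : Finset α).powerset, (if F.lab R' = 0 ∧ S ⊆ R' ∧ R' ⊆ (i.1.1 ∪ i.1.2)ᶜ then (1 : ZMod 2) else 0)) else 0)) = 0 := by
    intro S hSP hS0 hS4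
    have hPS : s.1.1 ⊆ Sᶜ := fun x hx => mem_compl.2 fun hxS => (mem_compl.1 (hSP hxS)) hx
    -- hypothesis of the up-reader in the cube `Sᶜ`
    have H : ∀ T, T ⊆ Sᶜ \ s.1.1 → F.lab T = 1 → F.lab (Sᶜ \ T) ≠ 4 := by
      intro T hT hT1 hT4
      have hTc : F.lab Tᶜ = 4 := F.lab_eq_four_of_subset (fun x hx => mem_compl.2 (mem_sdiff.1 hx).2) hT4
      obtain ⟨x, hx⟩ := hpw T s.1.1 hT1 hQ1 hTc hPc
      exact (mem_sdiff.1 (hT (mem_inter.1 hx).1)).2 (mem_inter.1 hx).2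
    -- per-rainbow reading of the functional `Λ` (raw pairing + up-reader)
    have hread : ∀ i : ↥(F.dem.filter (fun d => F.IsRainbow d)), (∑ Y ∈ (Sᶜ \ s.1.1).powerset, (if F.lab (Sᶜ \ Y) = 4 then
        ∑ σ ∈ F.sup, (if σ.2 = S then
          (∑ R' ∈ (Sᶜ).powerset, (if F.lab R' = 0 ∧ (σ.1 ∪ σ.2)ᶜ ⊆ R' ∧ R' ⊆ Y then (1 : ZMod 2) else 0)) * F.rbVec i.1 σ
          else 0) else 0))
        = (if F.lab S = 0 ∧ S ⊆ (i.1.1 ∪ i.1.2)ᶜ ∧ F.lab (Sᶜ \ i.1.1) = 4 then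
            (∑ R' ∈ (Finset.univ : Finset α).powerset, (if F.lab R' = 0 ∧ S ⊆ R' ∧ R' ⊆ (i.1.1 ∪ i.1.2)ᶜ then (1 : ZMod 2) else 0))
            else 0) * (if s.1.1 ⊆ i.1.1 then 1 else 0) := by
      intro i
      obtain ⟨hid, hir⟩ := rfacts i
      by_cases hc : F.lab S = 0 ∧ S ⊆ (i.1.1 ∪ i.1.2)ᶜ ∧ F.lab (Sᶜ \ i.1.1) = 4
      · rw [if_pos hc]
        have hQ1S : i.1.1 ⊆ Sᶜ := by
          intro x hx; rw [mem_compl]; intro hxS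
          have := hc.2.1 hxS; rw [mem_compl, mem_union, not_or] at this; exact this.1 hx
        rw [← F.nu_read_up Sᶜ hPS hQ1S hS4 (F.dem_rainbow_facts hid hir).2.1 H, Finset.mul_sum]
        refine sum_congr rfl fun Y hY => ?_
        have hYS : Y ⊆ Sᶜ := (mem_powerset.1 hY).trans sdiff_subset
        by_cases hY4 : F.lab (Sᶜ \ Y) = 4
        · rw [if_pos hY4, if_pos hY4, F.rbVec_pair_bottom_raw hid hir hS0 hYS, if_pos hc]
        · rw [if_neg hY4, if_neg hY4, mul_zero]
      · rw [if_neg hc, zero_mul]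
        refine sum_eq_zero fun Y hY => ?_
        have hYS : Y ⊆ Sᶜ := (mem_powerset.1 hY).trans sdiff_subset
        by_cases hY4 : F.lab (Sᶜ \ Y) = 4
        · rw [if_pos hY4, F.rbVec_pair_bottom_raw hid hir hS0 hYS, if_neg hc]
        · rw [if_neg hY4]
    -- linearity: the functional applied to the dependency, rainbow by rainbow
    have hlin : ∀ Y, (∑ σ ∈ F.sup, (if σ.2 = S then
          (∑ R' ∈ (Sᶜ).powerset, (if F.lab R' = 0 ∧ (σ.1 ∪ σ.2)ᶜ ⊆ R' ∧ R' ⊆ Y then (1 : ZMod 2) else 0)) *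
            (∑ i : ↥(F.dem.filter (fun d => F.IsRainbow d)), g i * F.rbVec i.1 σ) else 0))
        = ∑ i : ↥(F.dem.filter (fun d => F.IsRainbow d)), g i * ∑ σ ∈ F.sup, (if σ.2 = S then
          (∑ R' ∈ (Sᶜ).powerset, (if F.lab R' = 0 ∧ (σ.1 ∪ σ.2)ᶜ ⊆ R' ∧ R' ⊆ Y then (1 : ZMod 2) else 0)) * F.rbVec i.1 σ
          else 0) := by
      intro Y
      rw [show (∑ i : ↥(F.dem.filter (fun d => F.IsRainbow d)), g i * ∑ σ ∈ F.sup, (if σ.2 = S then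
            (∑ R' ∈ (Sᶜ).powerset, (if F.lab R' = 0 ∧ (σ.1 ∪ σ.2)ᶜ ⊆ R' ∧ R' ⊆ Y then (1 : ZMod 2) else 0)) * F.rbVec i.1 σ
            else 0))
          = ∑ i : ↥(F.dem.filter (fun d => F.IsRainbow d)), ∑ σ ∈ F.sup, g i * (if σ.2 = S then
            (∑ R' ∈ (Sᶜ).powerset, (if F.lab R' = 0 ∧ (σ.1 ∪ σ.2)ᶜ ⊆ R' ∧ R' ⊆ Y then (1 : ZMod 2) else 0)) * F.rbVec i.1 σ
            else 0) from sum_congr rfl fun i _ => Finset.mul_sum _ _ _]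
      rw [Finset.sum_comm]
      refine sum_congr rfl fun σ _ => ?_
      by_cases h : σ.2 = S
      · rw [if_pos h, Finset.mul_sum]
        refine sum_congr rfl fun i _ => ?_
        rw [if_pos h]; ring
      · rw [if_neg h]
        symm
        exact sum_eq_zero fun i _ => by rw [if_neg h, mul_zero]
    -- the functional applied to the dependency vanishes
    have hzero : (∑ i : ↥(F.dem.filter (fun d => F.IsRainbow d)), g i * ((if F.lab S = 0 ∧ S ⊆ (i.1.1 ∪ i.1.2)ᶜ ∧ F.lab (Sᶜ \ i.1.1) = 4 then
            (∑ R' ∈ (Finset.univ : Finset α).powerset, (if F.lab R' = 0 ∧ S ⊆ R' ∧ R' ⊆ (i.1.1 ∪ i.1.2)ᶜ then (1 : ZMod 2) else 0))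
            else 0) * (if s.1.1 ⊆ i.1.1 then 1 else 0))) = 0 := by
      rw [show (∑ i : ↥(F.dem.filter (fun d => F.IsRainbow d)), g i * ((if F.lab S = 0 ∧ S ⊆ (i.1.1 ∪ i.1.2)ᶜ ∧ F.lab (Sᶜ \ i.1.1) = 4 then
            (∑ R' ∈ (Finset.univ : Finset α).powerset, (if F.lab R' = 0 ∧ S ⊆ R' ∧ R' ⊆ (i.1.1 ∪ i.1.2)ᶜ then (1 : ZMod 2) else 0))
            else 0) * (if s.1.1 ⊆ i.1.1 then 1 else 0)))
          = ∑ i : ↥(F.dem.filter (fun d => F.IsRainbow d)), ∑ Y ∈ (Sᶜ \ s.1.1).powerset, g i * (if F.lab (Sᶜ \ Y) = 4 then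
              ∑ σ ∈ F.sup, (if σ.2 = S then
                (∑ R' ∈ (Sᶜ).powerset, (if F.lab R' = 0 ∧ (σ.1 ∪ σ.2)ᶜ ⊆ R' ∧ R' ⊆ Y then (1 : ZMod 2) else 0)) * F.rbVec i.1 σ
                else 0) else 0) from
        sum_congr rfl fun i _ => by rw [← hread i, Finset.mul_sum]]
      rw [Finset.sum_comm]
      refine sum_eq_zero fun Y _ => ?_
      by_cases hY4 : F.lab (Sᶜ \ Y) = 4
      · rw [show (∑ i : ↥(F.dem.filter (fun d => F.IsRainbow d)), g i * (if F.lab (Sᶜ \ Y) = 4 then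
              ∑ σ ∈ F.sup, (if σ.2 = S then
                (∑ R' ∈ (Sᶜ).powerset, (if F.lab R' = 0 ∧ (σ.1 ∪ σ.2)ᶜ ⊆ R' ∧ R' ⊆ Y then (1 : ZMod 2) else 0)) * F.rbVec i.1 σ
                else 0) else 0))
            = ∑ i : ↥(F.dem.filter (fun d => F.IsRainbow d)), g i * ∑ σ ∈ F.sup, (if σ.2 = S then
                (∑ R' ∈ (Sᶜ).powerset, (if F.lab R' = 0 ∧ (σ.1 ∪ σ.2)ᶜ ⊆ R' ∧ R' ⊆ Y then (1 : ZMod 2) else 0)) * F.rbVec i.1 σ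
                else 0) from sum_congr rfl fun i _ => by rw [if_pos hY4]]
        rw [← hlin Y]
        refine sum_eq_zero fun σ hσ => ?_
        by_cases h : σ.2 = S
        · rw [if_pos h, hsum σ hσ, mul_zero]
        · rw [if_neg h]
      · exact sum_eq_zero fun i _ => by rw [if_neg hY4, mul_zero]
    -- compare termwise with the claim (maximality of `|Q1|`)
    refine Eq.trans (sum_congr rfl fun i _ => ?_) hzero
    by_cases hgi : g i = 0
    · rw [hgi, zero_mul, zero_mul]
    congr 1
    have hiT : i ∈ (Finset.univ : Finset ↥(F.dem.filter (fun d => F.IsRainbow d))).filter (fun i => g i ≠ 0) := mem_filter.2 ⟨mem_univ _, hgi⟩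
    by_cases hPi : s.1.1 ⊆ i.1.1
    · have heq : i.1.1 = s.1.1 := (Finset.eq_of_subset_of_card_le hPi (hmax i hiT)).symm
      rw [if_pos heq, if_pos hPi, mul_one]
      by_cases hSi : S ⊆ (i.1.1 ∪ i.1.2)ᶜ
      · rw [if_pos ⟨hS0, hSi, by rw [heq]; exact hS4⟩]
      · rw [if_neg fun h => hSi h.2.1]
        exact sum_eq_zero fun R' _ => if_neg fun h => hSi (h.2.1.trans h.2.2)
    · have hne' : i.1.1 ≠ s.1.1 := fun h => hPi (h ▸ subset_rfl)
      rw [if_neg hne', if_neg hPi, mul_zero]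
  -- STEP B: the cube theorem in the cube `(Q1 s)ᶜ` kills the dependency
  have huniq : ∀ i : ↥(F.dem.filter (fun d => F.IsRainbow d)), i.1.1 = s.1.1 → (i.1.1 ∪ i.1.2)ᶜ = (s.1.1 ∪ s.1.2)ᶜ → i = s := by
    intro i h1 h3
    obtain ⟨hdi, -, -, -⟩ := F.dem_rainbow_facts (rfacts i).1 (rfacts i).2
    have key2 : ∀ (a b : Finset α), Disjoint a b → b = (a ∪ (a ∪ b)ᶜ)ᶜ := by
      intro a b hab; ext x
      simp only [mem_compl, mem_union, not_or, not_and, not_not]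
      constructor
      · intro hx; exact ⟨fun ha => (Finset.disjoint_left.1 hab) ha hx, fun _ => hx⟩
      · rintro ⟨hxa, h⟩; exact h hxa
    have h2 : i.1.2 = s.1.2 := by
      rw [key2 i.1.1 i.1.2 hdi, key2 s.1.1 s.1.2 hdisj, h3, h1]
    exact Subtype.ext (Prod.ext h1 h2)
  -- the cross pair `Q3(i)` of the cube `(Q1 s)ᶜ` for rainbows with `Q1 i = Q1 s`
  have hcross : ∀ i : ↥(F.dem.filter (fun d => F.IsRainbow d)), i.1.1 = s.1.1 → (i.1.1 ∪ i.1.2)ᶜ ⊆ (s.1.1)ᶜ ∧ (s.1.1)ᶜ \ (i.1.1 ∪ i.1.2)ᶜ = i.1.2 := by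
    intro i hiP
    obtain ⟨hdi, -, -, -⟩ := F.dem_rainbow_facts (rfacts i).1 (rfacts i).2
    constructor
    · intro x hx
      rw [mem_compl, mem_union, not_or] at hx
      rw [mem_compl, ← hiP]; exact hx.1
    · ext x
      constructor
      · intro hx
        obtain ⟨hxU, hxc⟩ := mem_sdiff.1 hx
        rw [mem_compl, ← hiP] at hxU
        rw [mem_compl, not_not, mem_union] at hxc
        rcases hxc with h | h
        · exact absurd h hxU
        · exact h
      · intro hx
        refine mem_sdiff.2 ⟨?_, ?_⟩
        · rw [mem_compl, ← hiP]; exact fun h1 => (Finset.disjoint_left.1 hdi) h1 hx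
        · rw [mem_compl, not_not]; exact mem_union_right _ hx
  have hmemCR : ∀ i : ↥(F.dem.filter (fun d => F.IsRainbow d)), i.1.1 = s.1.1 → (i.1.1 ∪ i.1.2)ᶜ ∈ ((s.1.1)ᶜ).powerset.filter
      (fun Y => F.lab Y ≠ 0 ∧ F.lab Y ≠ 4 ∧ F.lab ((s.1.1)ᶜ \ Y) ≠ 0 ∧ F.lab ((s.1.1)ᶜ \ Y) ≠ 4 ∧ F.lab ((s.1.1)ᶜ \ Y) < F.lab Y) := by
    intro i hiP
    obtain ⟨-, -, hQ2i, hQ3i⟩ := F.dem_rainbow_facts (rfacts i).1 (rfacts i).2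
    obtain ⟨hQ3U, hUQ3⟩ := hcross i hiP
    refine mem_filter.2 ⟨mem_powerset.2 hQ3U, ?_, ?_, ?_, ?_, ?_⟩
    · rw [hQ3i]; decide
    · rw [hQ3i]; decide
    · rw [hUQ3, hQ2i]; decide
    · rw [hUQ3, hQ2i]; decide
    · rw [hUQ3, hQ2i, hQ3i]; decide
  have hlam := F.cross_kernel_trivial (s.1.1)ᶜ
    (fun Y => ∑ i : ↥(F.dem.filter (fun d => F.IsRainbow d)), (if i.1.1 = s.1.1 ∧ (i.1.1 ∪ i.1.2)ᶜ = Y then g i else 0)) (by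
    intro O hO hO0 hO4
    have hOU : O ⊆ (s.1.1)ᶜ := mem_powerset.1 hO
    have hOc : F.lab (Oᶜ \ s.1.1) = 4 := by
      rw [show Oᶜ \ s.1.1 = (s.1.1)ᶜ \ O from by ext x; simp only [mem_sdiff, mem_compl]; tauto]; exact hO4
    rw [show (∑ Y ∈ ((s.1.1)ᶜ).powerset.filter (fun Y => F.lab Y ≠ 0 ∧ F.lab Y ≠ 4 ∧ F.lab ((s.1.1)ᶜ \ Y) ≠ 0 ∧
            F.lab ((s.1.1)ᶜ \ Y) ≠ 4 ∧ F.lab ((s.1.1)ᶜ \ Y) < F.lab Y),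
          (∑ i : ↥(F.dem.filter (fun d => F.IsRainbow d)), (if i.1.1 = s.1.1 ∧ (i.1.1 ∪ i.1.2)ᶜ = Y then g i else 0)) *
            (∑ R' ∈ ((s.1.1)ᶜ).powerset, (if F.lab R' = 0 ∧ O ⊆ R' ∧ R' ⊆ Y then (1 : ZMod 2) else 0)))
        = ∑ i : ↥(F.dem.filter (fun d => F.IsRainbow d)), ∑ Y ∈ ((s.1.1)ᶜ).powerset.filter (fun Y => F.lab Y ≠ 0 ∧ F.lab Y ≠ 4 ∧ F.lab ((s.1.1)ᶜ \ Y) ≠ 0 ∧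
            F.lab ((s.1.1)ᶜ \ Y) ≠ 4 ∧ F.lab ((s.1.1)ᶜ \ Y) < F.lab Y),
            (if i.1.1 = s.1.1 ∧ (i.1.1 ∪ i.1.2)ᶜ = Y then g i else 0) *
              (∑ R' ∈ ((s.1.1)ᶜ).powerset, (if F.lab R' = 0 ∧ O ⊆ R' ∧ R' ⊆ Y then (1 : ZMod 2) else 0)) from by
      rw [Finset.sum_comm]; exact sum_congr rfl fun Y _ => Finset.sum_mul _ _ _]
    refine Eq.trans (sum_congr rfl fun i _ => ?_) (key O hOU hO0 hOc)
    by_cases hiP : i.1.1 = s.1.1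
    · obtain ⟨hQ3U, -⟩ := hcross i hiP
      rw [← Finset.sum_erase_add _ _ (hmemCR i hiP)]
      rw [show (∑ Y ∈ (((s.1.1)ᶜ).powerset.filter (fun Y => F.lab Y ≠ 0 ∧ F.lab Y ≠ 4 ∧ F.lab ((s.1.1)ᶜ \ Y) ≠ 0 ∧
              F.lab ((s.1.1)ᶜ \ Y) ≠ 4 ∧ F.lab ((s.1.1)ᶜ \ Y) < F.lab Y)).erase (i.1.1 ∪ i.1.2)ᶜ,
            (if i.1.1 = s.1.1 ∧ (i.1.1 ∪ i.1.2)ᶜ = Y then g i else 0) *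
              (∑ R' ∈ ((s.1.1)ᶜ).powerset, (if F.lab R' = 0 ∧ O ⊆ R' ∧ R' ⊆ Y then (1 : ZMod 2) else 0))) = 0 from
        sum_eq_zero fun Y hY => by rw [if_neg (fun h => (mem_erase.1 hY).1 h.2.symm), zero_mul], zero_add]
      rw [if_pos ⟨hiP, rfl⟩, if_pos hiP]
      congr 1
      rw [F.sum_pow_to 0 O (i.1.1 ∪ i.1.2)ᶜ (s.1.1)ᶜ hQ3U, F.sum_pow_to 0 O (i.1.1 ∪ i.1.2)ᶜ Finset.univ (subset_univ _)]
    · rw [if_neg hiP, mul_zero]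
      exact sum_eq_zero fun Y _ => by rw [if_neg (fun h => hiP h.1), zero_mul])
  have h0 := hlam (s.1.1 ∪ s.1.2)ᶜ (hmemCR s rfl)
  beta_reduce at h0
  rw [← Finset.sum_erase_add _ _ (mem_univ s)] at h0
  rw [show (∑ i ∈ (Finset.univ : Finset ↥(F.dem.filter (fun d => F.IsRainbow d))).erase s,
        (if i.1.1 = s.1.1 ∧ (i.1.1 ∪ i.1.2)ᶜ = (s.1.1 ∪ s.1.2)ᶜ then g i else 0)) = 0 from
    sum_eq_zero fun i hi => by
      rw [if_neg]
      rintro ⟨h1, h3⟩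
      exact (mem_erase.1 hi).1 (huniq i h1 h3), zero_add] at h0
  rw [if_pos ⟨rfl, rfl⟩] at h0
  exact hgs h0

/-- **★ FOR SUNFLOWERS WITHOUT A DISJOINT KERNEL-COMPLEMENT PAIR IN PETAL 1** (this work): `0 ≤ ZH`. [this work] -/
theorem ZH_nonneg_of_noDisjointKernelPair
    (hpw : ∀ P P' : Finset α, F.lab P = 1 → F.lab P' = 1 → F.lab Pᶜ = 4 → F.lab P'ᶜ = 4 → (P ∩ P').Nonempty) :
    0 ≤ F.ZH :=
  F.ZH_nonneg_of_rbVec_linearIndependent (F.rbVec_linearIndependent_of_noDisjointKernelPair hpw)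

end Sunflower

end Summit.CriticalPhenomena.PercolationContinuityZ3.Theorems.SunflowerPartition
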